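import Summits.BirchSwinnertonDyer.BirchSwinnertonDyer.Theorems.KimAtThreeD7uTamagawaCoreFrobenius
import Summits.BirchSwinnertonDyer.Rank1Residual.X11b.LocalKernelTamagawaExact
import HarnessLib

/-!
# The TAMAGAWA-DIVISIBLE bad places, III: on `p`-power torsion the core of `E[p^∞]^{I_v}` IS the
# `E₀`-part `M₀ = nonsingularPart` (points with non-singular reduction over `K_v^{nr}`)
# (cell `bsd-addord`, seat w2-tamdiv gen 4; route W2 `KimAtThreeKolyvagin`, items 19562 / 19560, «TamDiv∞»,
# POSITIVE exponent)

HONEST FRAMING: TOOL theorems (no definition, no named fact, no `sorry`); closes nothing by itself;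
nothing is booked; BSD is not proved by any of this.  Continues `KimAtThreeD7uTamagawaCore{,Frobenius}`.
This is the E-SPECIFIC input of the positive-exponent Tamagawa index (Rubin, *Euler Systems*, Lemma
1.3.5; Büyükboduk, JNT 129 (2009) §2.1.2 Remark 2; [MR04] Prop. 6.2.6): Grothendieck's description of the
`p`-part of the Néron component group, `Φ_v[p^∞] ≅ (E[p^∞]^{I_v}/div)^{Fr}` (SGA 7 IX §11), in the
tree's currency — the minimal model `X = M ⊗ K_v` (`M = W.localMinimalIntegralModel v`), its subgroup
`X₀(K_v)` of points with non-singular reduction (`nonsingularReductionSubgroup`;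
`c_v = [X(K_v) : X₀(K_v)]`, `localTamagawaNumber_eq_index_nonsingularReductionSubgroup`), and sub-cell
multr1-p2's `M₀ = nonsingularPart ≤ E(K̄)^{I_v}` (Silverman's `E₀(K_v^nr)`).

## What (any number field `K`, `v ∤ p`, `𝔓₀ = adicCompletionPrime K v`, core as in part I)

* §1 **core = `E₀`-part on torsion**: `mem_nonsingularPart_of_core` (a core point has non-singular
  reduction: `M₀` has finite index `g = p^a u` in `E(K̄)^{I_v}` (Kodaira–Néron over `K_v^nr`,
  `finiteIndex_nonsingularPart`), `g • y ∈ M₀` for a core `p^a`-th root `y` of `x`, and `u` is invertible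
  on `p`-primary torsion) and `core_of_mem_nonsingularPart` (an `I_v`-fixed `p`-power torsion point with
  non-singular reduction is a core point: `M₀[p^∞]` is `p`-divisible, (LocDiv)
  `localDivisible_nonsingular_torsion` + `exists_nsmul_eq_of_mem_nonsingularPart_of_localDivisible`).
* (sequel `KimAtThreeD7uTamagawaDescent`) **`natCard_decompositionFixed_nsmul_core_eq`**: for every `n`,
  `#{t ∈ E[p^∞]^{D_{𝔓₀}} : p^n • t ∈ core} = #{t ∈ E[p^∞]^{D_{𝔓₀}} : t ∈ core} · #Φ_v[p^n]` —
  Galois descent `E[p^∞]^{D_{𝔓₀}} → X(K_v) → Φ_v` (route p2's (g4) construction, as in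
  `relIndex_nonsingularPrimary_ker_eq_pow`) is additive with kernel the core (§1) and image EXACTLY
  `Φ_v[p^∞]` (rational `p`-power torsion reaches the `p`-Sylow of `Φ_v`,
  `exists_torsion_sub_mem_nonsingularReductionSubgroup`; torsion is algebraic); so the preimage of
  `Φ_v[p^n]` is counted by the kernel times `#Φ_v[p^n]`.  With `#Φ_v = c_v` this is the E-specific
  order `#(E(K_v)[p^∞]/E₀(K_v)[p^∞]) = (c_v)_p` in the form the level-`p^{k+1}` index needs.

Sequels: `KimAtThreeD7uTamagawaDescent` (the Galois-descent count), `KimAtThreeD7uTamagawaIndex`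
(`#𝓕_can(w)_k = #𝓕_u(w)_k · #Φ_w[p^{k+1}]` over `ℚ`).
References: A. Grothendieck, SGA 7 I, Exp. IX §11 (11.6–11.7); R. Greenberg, LNM 1716 (1999) §3 Lemma 3.3
(p. 87) and §4 p. 74; J. H. Silverman, *AEC* VII.§2, VII.3.1, Cor. VII.6.2, Prop. VII.6.3, Ex. 7.6;
K. Rubin, *Euler Systems* Lemma 1.3.5; K. Büyükboduk, JNT 129 (2009) §2.1.2 Remark 2.
-/

noncomputable section

-- the cell's Theorems namespace `Summit.BirchSwinnertonDyer.BirchSwinnertonDyer.…` repeats the summit name by design (D-0017)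
set_option linter.dupNamespace false

open scoped Classical NNReal NumberField
open Function Field IsDedekindDomain NumberField WeierstrassCurve
open Literature.NumberTheory.EllipticCurves Literature.NumberTheory.EllipticCurves.GreenbergSelmer
open Literature.NumberTheory.GaloisRepresentations
open Summit.BirchSwinnertonDyer.Rank1Residual.GaloisImage
open Summit.BirchSwinnertonDyer.Rank1Residual.GaloisImage.InertiaDivisible
open Summit.BirchSwinnertonDyer.Rank1Residual.X11b.AcSelmer
open Summit.BirchSwinnertonDyer.BirchSwinnertonDyer.Theorems.KimAtThreeD7uTamagawaCore

namespace Summit.BirchSwinnertonDyer.BirchSwinnertonDyer.Theorems.KimAtThreeD7uTamagawaComponent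

variable {K : Type} [Field K] [NumberField K] (W : WeierstrassCurve K) [W.IsElliptic] (p : ℕ)
  [hp : Fact p.Prime] {v : HeightOneSpectrum (𝓞 K)}

/-! ### §1 On `p`-power torsion, the core of `E[p^∞]^{I_v}` is the `E₀`-part `M₀ = nonsingularPart` -/

section NonsingularPart

variable {w : Valuation (AlgebraicClosure (v.adicCompletion K)) ℝ≥0}
  (hw : ∀ x, (w x : ℝ) =
    spectralNorm (v.adicCompletion K) (AlgebraicClosure (v.adicCompletion K)) x)
  {W₀ : WeierstrassCurve w.integer}
  (hW₀ : ((W.localMinimalIntegralModel v).map (algebraMap (v.adicCompletionIntegers K)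
      (v.adicCompletion K))).baseChange (AlgebraicClosure (v.adicCompletion K)) =
    W₀.baseChange (AlgebraicClosure (v.adicCompletion K)))
  {Φ : localPoints W (v.adicCompletion K) ≃+
    (((W.localMinimalIntegralModel v).map (algebraMap (v.adicCompletionIntegers K)
      (v.adicCompletion K))).baseChange (AlgebraicClosure (v.adicCompletion K))).toAffine.Point}
  (hΦ : ∀ (σ : absoluteGaloisGroup (v.adicCompletion K)) (Q : localPoints W (v.adicCompletion K)),
    Φ (σ • Q) = Affine.Point.map ((absoluteGaloisGroup.toAlgEquiv _ σ :
        AlgebraicClosure (v.adicCompletion K) ≃ₐ[v.adicCompletion K]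
          AlgebraicClosure (v.adicCompletion K)) :
        AlgebraicClosure (v.adicCompletion K) →ₐ[v.adicCompletion K]
          AlgebraicClosure (v.adicCompletion K)) (Φ Q))

/-- Local notation: `E(K̄)^{I_v}`, the `I_{𝔓₀}`-fixed algebraic points (the ambient group of `M₀`). -/
local notation3 "𝔉" => (FixedPoints.addSubgroup
  ↥((adicCompletionPrime K v).inertia (absoluteGaloisGroup K)) (WeierstrassCurve.geomPoints W))

include hw hΦ in
/-- **A core point has non-singular reduction** (`core ⊆ M₀`, any finite `v`, any `p`).  `M₀` has finite
index `g` in `E(K̄)^{I_v}` (`finiteIndex_nonsingularPart`), so `g • y ∈ M₀` for every `I_v`-fixed `y`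
(`AddSubgroup.nsmul_index_mem`); write `g = p^a u` with `p ∤ u`, take a core `p^a`-th root `y` of `x`,
and invert `u` modulo the `p`-power order of `y`: `x = p^a • y = c • (g • y) ∈ M₀`.
[cite: SilvermanAEC2009, Cor. VII.6.2 (with Thm. VII.6.1), as applied over `K^nr` in the proof of Thm. VII.7.1] -/
theorem mem_nonsingularPart_of_core (x : W.geomPrimaryTorsion p)
    (hx : ∀ k : ℕ, ∃ y : W.geomPrimaryTorsion p,
      (∀ i ∈ (adicCompletionPrime K v).inertia (absoluteGaloisGroup K), i • y = y) ∧ p ^ k • y = x)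
    (P : 𝔉) (hP : (P : W.geomPoints) = x) :
    P ∈ nonsingularPart W hW₀ Φ := by
  have hpp : p.Prime := hp.out
  haveI : (nonsingularPart W hW₀ Φ).FiniteIndex := finiteIndex_nonsingularPart hw hW₀ hΦ
  set g : ℕ := (nonsingularPart W hW₀ Φ).index with hgdef
  have hg0 : g ≠ 0 := AddSubgroup.FiniteIndex.index_ne_zero
  obtain ⟨a, u, hu, hgeq⟩ := Nat.exists_eq_pow_mul_and_not_dvd hg0 p hpp.ne_one
  -- a core `p^a`-th root `y` of `x`
  have hroot : ∀ (j : ℕ) (z : W.geomPrimaryTorsion p),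
      (∀ k : ℕ, ∃ y : W.geomPrimaryTorsion p,
        (∀ i ∈ (adicCompletionPrime K v).inertia (absoluteGaloisGroup K), i • y = y) ∧ p ^ k • y = z) →
      ∃ r : W.geomPrimaryTorsion p,
        (∀ k : ℕ, ∃ y : W.geomPrimaryTorsion p,
          (∀ i ∈ (adicCompletionPrime K v).inertia (absoluteGaloisGroup K), i • y = y) ∧ p ^ k • y = r) ∧
        p ^ j • r = z := by
    intro j
    induction j with
    | zero => exact fun z hz => ⟨z, hz, by rw [pow_zero, one_smul]⟩
    | succ j ih =>
      intro z hz
      obtain ⟨r, hrc, hr⟩ := ih z hz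
      obtain ⟨r', hr'c, hr'⟩ := exists_core_nsmul_eq_of_core W p hrc
      exact ⟨r', hr'c, by rw [pow_succ, mul_smul, hr', hr]⟩
  obtain ⟨y, hyc, hy⟩ := hroot a x hx
  have hyI : ∀ i ∈ (adicCompletionPrime K v).inertia (absoluteGaloisGroup K),
      i • (y : W.geomPoints) = y := fun i hi => by
    rw [← primaryComponent.coe_smul, smul_eq_of_core W p hyc hi]
  let yF : 𝔉 := ⟨(y : W.geomPoints), fun i => hyI i i.2⟩
  -- `g • y ∈ M₀`
  have hgy : g • yF ∈ nonsingularPart W hW₀ Φ := by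
    rw [hgdef]; exact AddSubgroup.nsmul_index_mem (nonsingularPart W hW₀ Φ) yF
  -- `u` is invertible modulo the order `p^N` of `y`
  obtain ⟨N, hN⟩ := (AddCommGroup.mem_primaryComponent).mp y.2
  have hNF : p ^ N • yF = 0 := Subtype.ext (by
    rw [AddSubmonoidClass.coe_nsmul, ZeroMemClass.coe_zero]; exact hN)
  have hcop : Nat.Coprime u (p ^ N) :=
    Nat.Coprime.pow_right N ((Nat.Prime.coprime_iff_not_dvd hpp).mpr hu).symm
  have hxF : P = p ^ a • yF :=
    Subtype.ext (by
      rw [AddSubmonoidClass.coe_nsmul, hP]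
      have h := congrArg (fun z : W.geomPrimaryTorsion p => (z : W.geomPoints)) hy
      simp only [AddSubmonoidClass.coe_nsmul] at h
      exact h.symm)
  rw [hxF]
  by_cases hN1 : p ^ N = 1
  · have hy0 : yF = 0 := by rw [← one_smul ℕ yF, ← hN1, hNF]
    rw [hy0, smul_zero]; exact zero_mem _
  · have h1 : 1 < p ^ N := by
      have := Nat.one_le_pow N p hpp.pos
      omega
    obtain ⟨c, -, hc⟩ := Nat.exists_mul_mod_eq_one_of_coprime hcop h1
    have key : (c * u) • yF = yF := by
      conv_lhs => rw [mul_comm c u, ← Nat.mod_add_div (u * c) (p ^ N), hc]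
      rw [add_smul, one_smul, mul_comm, mul_smul, hNF, smul_zero, add_zero]
    have e : p ^ a • yF = c • (g • yF) := by
      rw [hgeq, smul_smul, ← mul_assoc, mul_comm c, mul_assoc, ← smul_smul (p ^ a) (c * u), key]
    rw [e]
    exact AddSubgroup.nsmul_mem _ hgy c

include hw hΦ in
/-- **An `I_v`-fixed `p`-power torsion point with non-singular reduction is a core point**
(`M₀[p^∞] ⊆ core`, `v ∤ p`): `M₀[p^∞]` is `p`-divisible — (LocDiv) `localDivisible_nonsingular_torsion`
transported by `exists_nsmul_eq_of_mem_nonsingularPart_of_localDivisible` — so iterating gives `I_v`-fixed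
`p^k`-th roots inside `M₀` for every `k` (the road of row T-URTAM's (ROOT) after its Bézout step).
[cite: SilvermanAEC2009, VII.§2 Prop. 2.1, Prop. VII.5.1, Prop. VII.3.1]
[cite: GreenbergLNM1716, §3 Lemma 3.3 (p. 87) with the remark after its proof (p. 88)] -/
theorem core_of_mem_nonsingularPart (hpv : (p : 𝓞 K) ∉ v.asIdeal)
    {𝔐 : Ideal v.localAbsIntegers} (h𝔐 : 𝔐 ∈ v.localPrimesAbove)
    (x : W.geomPrimaryTorsion p) (P₀ : 𝔉) (hP₀coe : (P₀ : W.geomPoints) = x)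
    (hxM : P₀ ∈ nonsingularPart W hW₀ Φ) :
    ∀ k : ℕ, ∃ y : W.geomPrimaryTorsion p,
      (∀ i ∈ (adicCompletionPrime K v).inertia (absoluteGaloisGroup K), i • y = y) ∧ p ^ k • y = x := by
  have hpu : IsUnit ((p : ℕ) : v.adicCompletionIntegers K) := by
    have h := HeightOneSpectrum.isUnit_algebraMap_adicCompletionIntegers K v hpv
    rwa [map_natCast] at h
  obtain ⟨j, hj⟩ := (AddCommGroup.mem_primaryComponent).mp x.2
  have hP₀j : p ^ j • P₀ = 0 :=
    Subtype.ext (by rw [AddSubmonoidClass.coe_nsmul, ZeroMemClass.coe_zero, hP₀coe]; exact hj)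
  have hP₀prim : P₀ ∈ AddCommGroup.primaryComponent 𝔉 p :=
    (AddCommGroup.mem_primaryComponent).mpr ⟨j, hP₀j⟩
  have hdivM₀ := exists_nsmul_eq_of_mem_nonsingularPart_of_localDivisible hw hW₀ hΦ h𝔐 hpu
    (fun Q hfix hQ hk ↦ localDivisible_nonsingular_torsion W v hpv w hw 𝔐 h𝔐 Q hfix hQ hk)
  intro k
  have key : ∀ k : ℕ, ∃ b : 𝔉,
      b ∈ AddCommGroup.primaryComponent 𝔉 p ∧ b ∈ nonsingularPart W hW₀ Φ ∧ p ^ k • b = P₀ := by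
    intro k
    induction k with
    | zero => exact ⟨P₀, hP₀prim, hxM, by rw [pow_zero, one_nsmul]⟩
    | succ k ih =>
      obtain ⟨b, hbprim, hbM₀, hb⟩ := ih
      obtain ⟨b', hb'prim, hb'M₀, hb'⟩ := hdivM₀ b hbprim hbM₀
      exact ⟨b', hb'prim, hb'M₀, by rw [pow_succ, ← smul_smul, hb', hb]⟩
  obtain ⟨b, hbprim, -, hb⟩ := key k
  obtain ⟨k', hk'⟩ := (AddCommGroup.mem_primaryComponent).mp hbprim
  have hk'' : p ^ k' • (b : W.geomPoints) = 0 := by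
    have h := congrArg (fun z : 𝔉 ↦ (z : W.geomPoints)) hk'
    simpa only [AddSubmonoidClass.coe_nsmul, ZeroMemClass.coe_zero] using h
  refine ⟨⟨(b : W.geomPoints), (AddCommGroup.mem_primaryComponent).mpr ⟨k', hk''⟩⟩,
    fun i hi ↦ Subtype.ext ?_, Subtype.ext ?_⟩
  · rw [primaryComponent.coe_smul]
    exact b.2 ⟨i, hi⟩
  · have h := congrArg (fun z : 𝔉 ↦ (z : W.geomPoints)) hb
    rw [← hP₀coe]
    simpa only [AddSubmonoidClass.coe_nsmul] using h

end NonsingularPart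


end Summit.BirchSwinnertonDyer.BirchSwinnertonDyer.Theorems.KimAtThreeD7uTamagawaComponent

end
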